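import Literature.NumberTheory.GaloisRepresentations.OrdinaryCrystallineSymplecticLift
import Literature.NumberTheory.GaloisRepresentations.SymplecticMultiplier
import Literature.NumberTheory.GaloisRepresentations.LabelledHodgeTateWeights
import HarnessLib

/-!
# Geometric lifts of odd irreducible `ρ̄ : Γ_ℚ → GSp₄(𝔽_p)` with a prescribed crystalline-ordinary
# component at `p` and multiplier `ε_p⁻¹` (Fakhruddin–Khare–Patrikis 2021, Thm. A, for `G = GSp₄`
# over `ℚ`, with Gee–Geraghty 2012, Lemma 7.2.3, for the ordinary components)

Topic `Literature/NumberTheory/GaloisRepresentations`; sequel of `OrdinaryCrystallineSymplecticLift`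
(the interface `IsOrdinarySymplecticLocalLiftAt` and the local input, Gee–Geraghty's Lemma 7.6.7).
Cite item of the crux `stmt-Langlands-17765`
(`Summit.Langlands.Langlands.Theses.AbelianSurfaceSerre.SerreGSp4Surjective`), line
`singer-type-evaporation`, stub `stub_liftExists` (the GLOBAL step: from `ρ̄ : Γ_ℚ → GSp₄(𝔽_p)` odd,
irreducible on `Γ_{ℚ(ζ_p)}`, and a crystalline ordinary symplectic lift of `ρ̄|Γ_{ℚ_p}`, to a
`p`-adic `r : Γ_ℚ → GSp₄(ℚ̄_p)` unramified almost everywhere, crystalline-ordinary at `p` with the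
same exponents, multiplier EXACTLY `ε_p⁻¹`, reducing to `ρ̄`).  ONE NAMED FACT (D-0014),
`FKP2021_thmA_ordinaryCrystallineLift_GSp4_rat`, a COMPOSITE of two printed theorems documented
step by step below (the model is the accepted `CompatibleSystemIrreducibility`, Patrikis–Taylor
transported along BLGGT Cor. 4.5.2).

## The printed statements (held texts arXiv:1904.02374 and arXiv:1001.2044, read 2026-08-17)

[FKP] N. Fakhruddin, C. Khare, S. Patrikis, *Relative deformation theory, relative Selmer groups,
and lifting irreducible Galois representations*, Duke Math. J. 170 (2021) [FakhruddinKharePatrikis2021].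
Numbering of the held arXiv text: the main theorem is **Theorem 6.11** (§6.3) = **Theorem A**
(= Theorem 1 of the Introduction, "See Theorem 6.11").

* **Notation** (§1.4, §2, pp. 11–12): `𝒪` the ring of integers of a finite `E/ℚ_p`, residue field
  `k`; "`G` will be a smooth group scheme over `𝒪` … such that `G⁰` is split connected reductive, and
  `G/G⁰` is finite étale of order prime to `p`"; `G^{der}` the derived group of `G⁰`;
  "`Ĝ(𝒪') := ker(G(𝒪') → G(k'))`"; **Assumption 2.1**: "`p ≠ 2` is very good for `G^{der}` … We
  also assume that the canonical central isogeny `G^{der} × Z⁰_G → G⁰` has kernel of order prime to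
  `p`"; lifts of type `μ`: "fix a lift `μ : Γ → G/G^{der}(𝒪)` of `μ̄ := ρ̄ (mod G^{der})` …
  `Lift^μ_ρ̄(R) ⊂ Lift_ρ̄(R)` the subset of lifts `ρ` such that `ρ (mod G^{der}) = μ`".
* **Definition 1.2** (p. 3): "We say `ρ̄ : Γ_F → G(𝔽̄_p)` is odd if for all `v ∣ ∞`,
  `h⁰(Γ_{F_v}, ρ̄(𝔤^{der})) = dim(Flag_{G⁰})`."  **Appendix A** (p. 49): "`Γ ⊂ G(k)`, with `G` a
  connected reductive group over `k`, is absolutely irreducible if `Γ` is not contained in any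
  proper parabolic subgroup of `G_{k̄}`."
* **Theorem 6.11 = Theorem A** (pp. 40–41), verbatim: "Let `p ≫_G 0` be a prime. Let `F` be a
  totally real field, and let `ρ̄ : Γ_{F,𝒮} → G(k)` be a continuous representation unramified
  outside a finite set of finite places `𝒮` containing the places above `p`. Let `F̃` denote the
  smallest extension of `F` such that `ρ̄(Γ_F̃)` is contained in `G⁰(k)`, and assume that
  `[F̃(ζ_p) : F̃]` is strictly greater than the integer `a_G` arising in Lemma 8.6 (Appendix A)
 (which depends only on the root datum of `G`). Fix a lift `μ : Γ_{F,𝒮} → G/G^{der}(𝒪)` of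
  `μ̄ = ρ̄ (mod G^{der})`, and assume that `ρ̄` satisfies the following: • `ρ̄` is odd, i.e. for all
  infinite places `v` of `F`, `h⁰(Γ_{F_v}, ρ̄(𝔤^{der})) = dim(Flag_{G^{der}})`. • `ρ̄|_{Γ_{F̃(ζ_p)}}`
  is absolutely irreducible. • For all `v ∈ 𝒮`, `ρ̄|_{Γ_{F_v}}` has a lift `ρ_v : Γ_{F_v} → G(𝒪)` of
  type `μ|_{Γ_{F_v}}`; and that for `v ∣ p` this lift may be chosen to be de Rham and regular in
  the sense that the associated Hodge–Tate cocharacters are regular.  Then there exist a finite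
  extension `E'` of `E = Frac(𝒪)` (whose ring of integers and residue field we denote by `𝒪'` and
  `k'`), and depending only on the set `{ρ_v}_{v ∈ 𝒮}`; a finite set of places `𝒮̃` containing `𝒮`;
  and a geometric lift `ρ : Γ_{F,𝒮̃} → G(𝒪')` of `ρ̄`, and having multiplier `μ`, such that
  `ρ(Γ_F)` contains `Ĝ^{der}(𝒪')`. Moreover, if we fix an integer `t₀` and for each `v ∈ 𝒮` an
  irreducible component defined over `𝒪` and containing `ρ_v` of: • for `v ∈ 𝒮 ∖ {v ∣ p}`, the
  generic fiber of the local lifting ring, `R^{□,μ}_{ρ̄|Γ_{F_v}}[1/ϖ]` …; and • for `v ∣ p`, the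
  lifting ring `R^{□,μ,𝐯}_{ρ̄|Γ_{F_v}}[1/ϖ]` whose `Ē`-points parametrize lifts of `ρ̄|_{Γ_{F_v}}` with
  specified Hodge type `𝐯` (see [Balaji] for the construction of this ring); then the global lift
  `ρ` may be constructed such that, for all `v ∈ 𝒮`, `ρ|_{Γ_{F_v}}` is congruent modulo `ϖ^{t₀}` to
  some `Ĝ(𝒪')`-conjugate of `ρ_v`, and `ρ|_{Γ_{F_v}}` belongs to the specified irreducible
  component for every `v ∈ 𝒮`."
* **Remark 6.16** (p. 44): "When `G = GL_n`, `GSp_{2n}`, or `GO_n`, local lifts `ρ_v` as in the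
  theorem statement are known to exist for `v ∤ p`, by [Clozel–Harris–Taylor] and [Booher,
  *Minimally ramified deformations when ℓ ≠ p*, Compos. Math. 155 (2019)] (after possibly replacing
  `k` with a finite extension)."  **Remark 6.17**: "the bound in Theorem 6.11 can be made
  effective" (not computed).  **§4.2** (p. 20): the rings `R^{□,μ,𝐯}_ρ̄` at `v ∣ p` are the fixed
  multiplier, fixed `p`-adic Hodge type `𝐯` lifting rings of [Balaji, *G-valued potentially
  semi-stable deformation rings*, thesis, Chicago 2012] (for `G = GSp₄` and the standard
  representation these are Kisin's potentially crystalline / semi-stable rings with a symplectic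
  condition, as in [GG] §7.2 below; [Bellovin–Gee] for their generic fibres).

[GG] T. Gee, D. Geraghty, *Companion forms for unitary and symplectic groups*, Duke Math. J. 161
(2012) [GeeGeraghty2012] (quoted further in the companion file):
* **§7.2** (p. 22): "Suppose that `p = l`. Let `λ ∈ (ℤ⁴_+)^{Hom(M,K)}` and let `𝐯_λ` be the
  associated `l`-adic Hodge type. Corollary 2.7.7 of [Kisin, *Potentially semi-stable deformation
  rings*] shows that there is a unique `l`-torsion-free quotient `R^{sympl,𝐯_λ,cr}_ρ̄` of
  `R^{□,sympl}_ρ̄` with the property that for any finite `K`-algebra `B`, a homomorphism of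
  `𝒪`-algebras `R^□_ρ̄ → B` factors through `R^{sympl,𝐯_λ,cr}_ρ̄` if and only if the corresponding
  representation is crystalline of `l`-adic Hodge type `𝐯_λ`" (and `R^{sympl,𝐯_λ,cr,ψ}` with the
  similitude factor fixed to `ψ`, used in Lemma 7.2.3 and Thm. 7.5.2).
* **Lemma 7.2.3** (p. 25), verbatim: "Let `M` be a finite extension of `ℚ_l`. There is a quotient
  `R^{sympl,△_λ,cr,ψ}_ρ̄` of `R^{sympl,𝐯_λ,cr,ψ}_ρ̄` corresponding to a union of irreducible
  components such that for any finite local `K`-algebra `B`, a homomorphism of `𝒪`-algebras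
  `ζ : R^{sympl,𝐯_λ,cr,ψ}_ρ̄ → B` factors through `R^{sympl,△_λ,cr,ψ}_ρ̄` if and only if `ζ ∘ ρ^□` is
  ordinary of weight `λ`."  (`GL_n` version: Lemma 3.1.7 from [Geraghty] Lemma 3.3.3.)  After
  Def. 3.1.6 (p. 7): "if `ρ : G_M → GL_n(E)` is ordinary of weight `λ`, then `ρ` is of `l`-adic
  Hodge type `𝐯_λ`."

## The rendering, and why it follows from print (read before reviewing)

Statement rendered: there is `p₀` such that for every prime `p ≥ p₀`, every
`ρ̄ : Γ_ℚ → GL₄(𝔽_p)` (`FramedGaloisRep ℚ (ZMod p) 4`) preserving an alternating non-degenerate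
`J` up to `ε̄_p⁻¹` (VERBATIM the first three clauses of the crux's (H1)), whose base change to `𝔽̄_p`
restricted to `ker ε̄_p = Γ_{ℚ(ζ_p)}` is irreducible (VERBATIM the crux's `IrredOnCycKernel`), every
strictly decreasing `e : Fin 4 → ℤ`, and, at the place `v ∣ p`, every crystalline ordinary
symplectic local lift `r_v` of `ρ̄|Γ_{ℚ_v}` with exponents `e` and multiplier `ε⁻¹`
(`IsOrdinarySymplecticLocalLiftAt`, companion file): THERE IS `r : Γ_ℚ → GL₄(ℚ̄_p)` continuous,
unramified at almost all places, symplectic with multiplier EXACTLY `ε_p⁻¹`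
(`IsSymplecticWithMultiplierFun`, the idiom of the accepted BLGGT facts), whose integral
characteristic polynomials reduce to those of `ρ̄ ⊗ 𝔽̄_p` along some `red : 𝒪_{ℚ̄_p} → 𝔽̄_p`
(VERBATIM the crux's device `ReducesTo`), and which at `v ∣ p` is crystalline for Fontaine's pinned
datum with labelled Hodge–Tate weights `{-e₀, -e₁, -e₂, -e₃}` for every `ℚ_p`-label and ordinary
with the SAME exponents `e` (`FramedRep.IsCrystallineOrdinaryOfExponents`).

Derivation:
1. (The group.)  `G = GSp₄` over `ℤ_p` ([GG] §7.1), split connected reductive, `G^{der} = Sp₄`,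
   `Z_{G⁰} = 𝔾_m`, `G/G^{der} = 𝔾_m` through the similitude `ν`, `G^{der} ∩ Z = μ₂`.  For `p ≥ 3`
   Assumption 2.1 holds (`p ≠ 2` is very good for type `C₂`; the central isogeny `Sp₄ × 𝔾_m → GSp₄`
   has kernel `μ₂`).  All alternating non-degenerate forms on `k⁴` are equivalent (Darboux), so
   after a change of basis over `𝔽_p` our `ρ̄` is `ρ̄ : Γ_ℚ → GSp₄(𝔽_p) = G(k)`, `k = 𝔽_p`,
   `𝒪 = ℤ_p` to begin with (FKP allow replacing `k` by a finite extension, Remark 6.16, which the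
   local data below may require), with `μ̄ = ν ∘ ρ̄ = ε̄_p⁻¹`; `F = F̃ = ℚ` (`G` connected) and
   `[ℚ(ζ_p) : ℚ] = p - 1 > a_G` for `p` large.  We FIX `μ := ε_p⁻¹ : Γ_ℚ → 𝔾_m(ℤ_p)`, a geometric
   (crystalline) lift of `μ̄`.  `𝒮 :=` the primes at which `ρ̄` ramifies, together with `p` (finite:
   `ρ̄` has finite image).  The bound `p₀` of the statement is FKP's non-effective `p ≫_{GSp₄} 0`
   (Remark 6.17), taken `≥ 3` and with `p - 1 > a_{GSp₄}`.
2. (Oddness, Def. 1.2.)  Complex conjugation `c` has `ν(ρ̄(c)) = ε̄_p(c)⁻¹ = -1` and `ρ̄(c)² = 1`, so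
   its `±1`-eigenspaces `V_±` are both ISOTROPIC (`⟨x, y⟩ = ⟨cx, cy⟩ν(c)⁻¹ = -⟨x, y⟩` on `V_+`), hence
   Lagrangian planes in duality; the centraliser of `ρ̄(c)` in `Sp₄` is `GL(V_+) ≅ GL₂`, of
   dimension `4 = dim Sp₄ - dim B_{Sp₄} = 10 - 6 = dim Flag_{Sp₄}`, i.e.
   `h⁰(Γ_ℝ, ρ̄(𝔰𝔭₄)) = 4 = dim Flag_{G^{der}}`: `ρ̄` is odd (Gross' parity condition; this is the
   computation behind "`GSp₄`-valued with odd similitude character is odd").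
3. (Irreducibility.)  `ρ̄ ⊗ 𝔽̄_p` restricted to `Γ_{ℚ(ζ_p)}` has no invariant proper subspace, a
   fortiori no invariant isotropic flag, i.e. `ρ̄(Γ_{ℚ(ζ_p)})` lies in no proper parabolic subgroup of
   `GSp₄,𝔽̄_p` (these are the stabilisers of isotropic subspaces): absolutely irreducible in the sense
   of Appendix A.
4. (Local lifts.)  At `v ∈ 𝒮`, `v ≠ p`: lifts of type `μ` exist by Remark 6.16 (`G = GSp₄`; after
   possibly enlarging `k`).  At `v = p`: the datum `IsOrdinarySymplecticLocalLiftAt p ρ̄ J v hv e r_v`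
   gives `r_v : Γ_{ℚ_v} → GL₄(𝒪_{ℚ̄_p})`; its image is compact, hence (Baire) contained in
   `GL₄(𝒪_{E₁})` for a finite `E₁/ℚ_p`, which we enlarge to contain the entries of `J_v`; `red`
   restricted to `𝒪_{E₁}` is the reduction modulo `ϖ₁` followed by an embedding `j : k₁ ↪ 𝔽̄_p`, and
   clause (i) says `r_v mod ϖ₁ = ρ̄|Γ_{ℚ_v} ⊗_{𝔽_p} k₁` (read through `j`), clause (ii) that `J_v` is
   a unimodular alternating form over `𝒪_{E₁}` (its reduction `J` is non-degenerate) reducing to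
   `J`, preserved by `r_v` with multiplier `ε_v⁻¹ = μ|Γ_{ℚ_v}` (`ε_ℚ ∘ res_v = ε_{ℚ_v}`).  A
   symplectic basis for `J_v` over the local ring `𝒪_{E₁}` lifting the one chosen for `J` in step 1
   conjugates `(ρ̄, J)` and `(r_v, J_v)` simultaneously to `GSp₄ = GSp(J₀)`-valued homomorphisms: `r_v`
   becomes a lift `ρ_p : Γ_{ℚ_p} → G(𝒪_{E₁})` of `ρ̄|Γ_{ℚ_p}` of type `μ`.  By (iii)–(iv) it is
   crystalline and ordinary with diagonal `u_i ε^{e_i}`, `u_i` unramified, `e` strictly decreasing: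
   de Rham with REGULAR Hodge–Tate cocharacter (weights `-e₀ < -e₁ < -e₂ < -e₃`), i.e. crystalline of
   `p`-adic Hodge type `𝐯_λ`, `λ = (-e₃-3, -e₂-2, -e₁-1, -e₀)`, and ordinary of weight `λ`
   ([GG] Def. 3.1.2–3.1.3 and the remark after Def. 3.1.6).
5. (The component.)  `ρ_p` is an `𝒪_{E₁}`-point of `R := R^{sympl,𝐯_λ,cr,ε⁻¹}_{ρ̄|Γ_{ℚ_p}}` ([GG] §7.2
   with similitude factor fixed), which is [FKP]'s `R^{□,μ,𝐯_λ}` for `G = GSp₄` (both are the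
   `p`-torsion-free quotient of the fixed-multiplier symplectic lifting ring whose points in finite
   local `ℚ_p`-algebras are the crystalline lifts of Hodge type `𝐯_λ`; [Balaji] constructs it for
   general `G`, [GG] for `GSp₄` from [Kisin] Cor. 2.7.7).  By [GG] Lemma 7.2.3 the ordinary locus
   `Spec R^{sympl,△_λ,cr,ε⁻¹}` is a UNION OF IRREDUCIBLE COMPONENTS of `Spec R`; since `ρ_p` is
   ordinary of weight `λ` it lies on (at least) one of them, `C`, which after enlarging `E₁` is
   geometrically irreducible ("defined over `𝒪`").  We prescribe `C` at `p` (and any components at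
   `v ∈ 𝒮 ∖ {p}`, `t₀ = 1`).
6. (Theorem A.)  Output: `E'`, `𝒮̃ ⊇ 𝒮` finite, and `ρ : Γ_{ℚ,𝒮̃} → GSp₄(𝒪')` geometric with
   `ν ∘ ρ = μ = ε⁻¹`, `ρ mod ϖ' = ρ̄ ⊗ k'`, `ρ|Γ_{ℚ_p} ∈ C ⊂ Spec R^{sympl,△_λ,cr,ε⁻¹}`: so `ρ|Γ_{ℚ_p}`
   is crystalline of Hodge type `𝐯_λ` (labelled Hodge–Tate weights `{(j-1) + λ_{5-j}} = {-e_i}`) and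
   ordinary of weight `λ` — conjugate to an upper triangular representation whose diagonal
   characters `ψ_i` agree with `χ_i^λ = ε^{e_i}` on an open subgroup of inertia; being subquotients
   of a crystalline representation the `ψ_i` are crystalline, so `ψ_i ε^{-e_i}` is crystalline of
   Hodge–Tate weight `0`, hence unramified: `ψ_i = u_i ε^{e_i}` with `u_i` unramified, which is
   `FramedRep.IsCrystallineOrdinaryOfExponents p (r.toLocal v) e`.
7. (Reading the output in the tree.)  `r := ρ` pushed into `GL₄(ℚ̄_p)` (undoing the basis change
   of step 1 by a lift `P̃ ∈ GL₄(𝒪')` of it): continuous, unramified outside the finite `𝒮̃`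
   (`∀ᶠ v in cofinite, IsUnramifiedAt`); symplectic for the alternating unimodular `P̃ᵀ J₀ P̃` with
   multiplier `ε_p⁻¹` (`IsSymplecticWithMultiplierFun r (g ↦ ε_p(g)⁻¹)`); its characteristic
   polynomials lie in `𝒪'[X] ⊂ 𝒪_{ℚ̄_p}[X]` and reduce modulo `ϖ'` to those of `ρ̄`, which is the
   `ReducesTo` clause along `red' : 𝒪_{ℚ̄_p} → 𝒪_{ℚ̄_p}/𝔪 ≅ 𝔽̄_p` chosen to extend
   `k' ↪ 𝔽̄_p ⊇ 𝔽_p` (any two identifications differ by an automorphism of `𝔽̄_p` over `𝔽_p`);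
   at `v ∣ p` "crystalline" is `IsCrystallineFramed` for the pinned Fontaine datum (as in every
   statement of the summit) and the labelled weights are those of the Hodge type `𝐯_λ` for every
   `ℚ_p`-label `τ : ℚ_v → ℚ̄_p` (there is one).
* WEAKER than print / NOT here:
  -- TODO(general form): Theorem A itself — general `G`, totally real `F`, any geometric `μ`, the
  -- approximation modulo `ϖ^{t₀}` of the `ρ_v`, prescribed components at `v ∤ p`, image containing
  -- `Ĝ^{der}(𝒪')`; the ordinary component could be replaced by any component of any regular
  -- Hodge-type lifting ring; residual coefficients a general finite `k`; the effective bound `p₀`.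
  -- Theorem B / the infinitely ramified variants are not rendered.

## References

* [FakhruddinKharePatrikis2021] Duke Math. J. 170 (2021) 3505–3599: Thm. A = Thm. 6.11, Def. 1.2,
  Assumption 2.1, §2 (lifts of type `μ`), §4.2 / Prop. 4.7, Rem. 6.16–6.17, Appendix A (definition
  of absolute irreducibility; Lemma 8.6 for `a_G`) (arXiv:1904.02374 pp. 40–41, 3, 12, 20, 44, 49–50).
* [GeeGeraghty2012] Duke Math. J. 161 (2012): §7.1–7.2, Lemma 7.2.3, Def. 3.1.2–3.1.3, remark after
  Def. 3.1.6, Lemma 3.1.7 (arXiv:1001.2044 pp. 22, 25, 6–8).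
* S. Balaji, *G-valued potentially semi-stable deformation rings*, thesis (Chicago 2012);
  R. Bellovin, T. Gee, *G-valued local deformation rings and global lifts*, Algebra Number Theory 13
  (2019) (the rings `R^{□,μ,𝐯}` and their generic fibres); M. Kisin, J. Amer. Math. Soc. 21 (2008),
  Cor. 2.7.7, Thm. 3.3.8; D. Geraghty, thesis (Harvard 2010), Lemma 3.3.3.
* J. Booher, Compos. Math. 155 (2019); L. Clozel, M. Harris, R. Taylor, Publ. Math. IHÉS 108 (2008),
  §2.4.4 (local lifts at `v ∤ p`).
* B. Gross, *Odd Galois representations* (preprint), the parity condition of Def. 1.2.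
-/

noncomputable section

open scoped MatrixGroups Matrix NumberField
open NumberField IsDedekindDomain Field Filter

namespace Literature.NumberTheory.GaloisRepresentations

/-- **Fakhruddin–Khare–Patrikis 2021, Theorem A (= Thm. 6.11), for `G = GSp₄` over `F = ℚ` with
multiplier `μ = ε_p⁻¹` and the ordinary crystalline component at `p` (Gee–Geraghty 2012,
Lemma 7.2.3)** — see the module docstring for the printed theorems and the seven-step derivation of
this rendering.  There is `p₀` such that for every prime `p ≥ p₀`: let `ρ̄ : Γ_ℚ → GL₄(𝔽_p)` be
continuous and preserve an alternating non-degenerate `J` up to the multiplier `ε̄_p⁻¹` (so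
`ρ̄ : Γ_ℚ → GSp₄(𝔽_p)` with odd similitude character `ε̄_p⁻¹`: ODD in the sense of Def. 1.2), with
`ρ̄ ⊗ 𝔽̄_p` irreducible on `Γ_{ℚ(ζ_p)} = ker ε̄_p` (absolutely irreducible in the `GSp₄` sense); let
`e₀ > e₁ > e₂ > e₃` be integers and suppose that at the place `v ∣ p` the restriction `ρ̄|Γ_{ℚ_v}` has
a crystalline ordinary symplectic lift `r_v` with exponents `e` and multiplier `ε⁻¹`
(`IsOrdinarySymplecticLocalLiftAt`: a de Rham, Hodge–Tate regular lift of type `μ`, on an ordinary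
component of the crystalline Hodge-type lifting ring by [GG] Lemma 7.2.3; lifts at the other
ramified primes exist by [FKP] Rem. 6.16).  THEN there is a continuous `r : Γ_ℚ → GL₄(ℚ̄_p)`,
unramified at almost all places, SYMPLECTIC WITH MULTIPLIER EXACTLY `ε_p⁻¹`, whose integral
characteristic polynomials reduce to those of `ρ̄ ⊗ 𝔽̄_p` along some `red : 𝒪_{ℚ̄_p} → 𝔽̄_p`, and
which at `v ∣ p` is CRYSTALLINE (pinned Fontaine datum) with labelled Hodge–Tate weights
`{-e₀, -e₁, -e₂, -e₃}` and ORDINARY WITH THE SAME EXPONENTS `e`.  Printed (Thm. A): "… Then there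
exist a finite extension `E'` of `E` …; a finite set of places `𝒮̃` containing `𝒮`; and a geometric
lift `ρ : Γ_{F,𝒮̃} → G(𝒪')` of `ρ̄`, and having multiplier `μ` … Moreover, if we fix … for each
`v ∈ 𝒮` an irreducible component defined over `𝒪` and containing `ρ_v` of … for `v ∣ p`, the lifting
ring `R^{□,μ,𝐯}_{ρ̄|Γ_{F_v}}[1/ϖ]` … then the global lift `ρ` may be constructed such that …
`ρ|_{Γ_{F_v}}` belongs to the specified irreducible component for every `v ∈ 𝒮`"; and [GG]
Lemma 7.2.3: "There is a quotient `R^{sympl,△_λ,cr,ψ}_ρ̄` of `R^{sympl,𝐯_λ,cr,ψ}_ρ̄` corresponding to a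
union of irreducible components such that … factors through `R^{sympl,△_λ,cr,ψ}_ρ̄` if and only if
`ζ ∘ ρ^□` is ordinary of weight `λ`."  Named fact (D-0014); users take
`(h : FKP2021_thmA_ordinaryCrystallineLift_GSp4_rat)`.
-- TODO(general form): general `G`, totally real `F`, any geometric `μ`, approximation of the local
-- lifts modulo `ϖ^{t₀}`, prescribed components away from `p`, big image of the lift, Theorem B.
[cite: FakhruddinKharePatrikis2021, Thm. A (= Thm. 6.11) with Def. 1.2, Assumption 2.1, Rem. 6.16 and Appendix A]
[cite: GeeGeraghty2012, Lemma 7.2.3 with §7.2 and Def. 3.1.2–3.1.3] -/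
def FKP2021_thmA_ordinaryCrystallineLift_GSp4_rat : Prop :=
  ∃ p₀ : ℕ, ∀ (p : ℕ) [Fact p.Prime], p₀ ≤ p →
    ∀ (ρ : FramedGaloisRep ℚ (ZMod p) 4) (J : Matrix (Fin 4) (Fin 4) (ZMod p)) (e : Fin 4 → ℤ),
      -- `ρ̄ : Γ_ℚ → GSp(J)(𝔽_p)` with multiplier `ε̄_p⁻¹` (odd)
      Jᵀ = -J → IsUnit J.det →
      (∀ g : absoluteGaloisGroup ℚ, (ρ g).valᵀ * J * (ρ g).val =
        (((modPCyclotomicCharacterZMod ℚ p g)⁻¹ : (ZMod p)ˣ) : ZMod p) • J) →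
      -- `ρ̄|_{Γ_{ℚ(ζ_p)}}` absolutely irreducible (`Γ_{ℚ(ζ_p)} = ker ε̄_p`)
      Representation.IsIrreducible
        (((FramedRep.baseChangeRepresentation (algebraMap (ZMod p) (AlgebraicClosure (ZMod p)))
              ρ).comp (modPCyclotomicCharacterZMod ℚ p).ker.subtype :
          Representation (AlgebraicClosure (ZMod p)) (modPCyclotomicCharacterZMod ℚ p).ker
            (Fin 4 → AlgebraicClosure (ZMod p)))) →
      -- Hodge–Tate regularity of the local datum: strictly decreasing exponents
      StrictAnti e →
      -- at `v ∣ p`: a crystalline ordinary symplectic local lift with exponents `e`, type `ε⁻¹`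
      (∀ (v : HeightOneSpectrum (𝓞 ℚ)) (hv : ((p : ℕ) : 𝓞 ℚ) ∈ v.asIdeal),
        ∃ rv : FramedRep (absoluteGaloisGroup (v.adicCompletion ℚ)) (PadicAlgCl p) 4,
          IsOrdinarySymplecticLocalLiftAt p ρ J v hv e rv) →
      -- CONCLUSION: a global lift, unramified a.e., symplectic-`ε_p⁻¹`, reducing to `ρ̄`,
      -- crystalline at `p` with weights `{-e_i}` and ordinary with exponents `e`
      ∃ r : FramedGaloisRep ℚ (PadicAlgCl p) 4,
        (∀ᶠ v : HeightOneSpectrum (𝓞 ℚ) in cofinite, r.IsUnramifiedAt v) ∧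
        r.IsSymplecticWithMultiplierFun (fun g => algebraMap ℚ_[p] (PadicAlgCl p)
          ((((GaloisRep.cyclotomicCharacter ℚ p g)⁻¹ : ℤ_[p]ˣ) : ℤ_[p]) : ℚ_[p])) ∧
        (∃ red : (Valued.v : Valuation (PadicAlgCl p) NNReal).valuationSubring →+*
            AlgebraicClosure (ZMod p),
          ∀ g : absoluteGaloisGroup ℚ,
            ∃ P : Polynomial (Valued.v : Valuation (PadicAlgCl p) NNReal).valuationSubring,
              P.map (Valued.v : Valuation (PadicAlgCl p) NNReal).valuationSubring.subtype =
                  FramedRep.charpoly r g ∧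
                P.map red = (FramedRep.charpoly ρ g).map
                  (algebraMap (ZMod p) (AlgebraicClosure (ZMod p)))) ∧
        ∀ (v : HeightOneSpectrum (𝓞 ℚ)) (hv : ((p : ℕ) : 𝓞 ℚ) ∈ v.asIdeal),
          (PAdicHodge.fontainePstAdicCompletion v p hv).IsCrystallineFramed (r.toLocal v) ∧
          (letI := (PAdicHodge.fontainePstAdicCompletion v p hv).algebra
           ∀ τ : v.adicCompletion ℚ →ₐ[ℚ_[p]] PadicAlgCl p,
            r.labelledHodgeTateWeightsAt v (PAdicHodge.fontainePstAdicCompletion v p hv).algebra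
              (PAdicHodge.fontainePstAdicCompletion v p hv).𝔅 τ.toRingHom =
              (Finset.univ.val.map fun i => -(e i))) ∧
          FramedRep.IsCrystallineOrdinaryOfExponents p (r.toLocal v) e

end Literature.NumberTheory.GaloisRepresentations

end
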